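import Summits.AtomisticToContinuum.Crystallization.Theorems.ChartedZeroExcessLayeredLatticeLiouvilleTO
import Summits.AtomisticToContinuum.Crystallization.Theorems.ChartedZeroExcessLayeredLatticeLiouvilleTearFree

/-!
# Charted zero excess · layered lattice Liouville — (Υb) «UntwistBookkeepingP» PROVED at the pattern-scale ceiling `aHi = 1`

decomp-a2c prover hand-1 (generation 18), (S)-lane.  Part TM (lens-2 g37) split the untwist (Υ) of the 26636 column into the rigidity half
(Υc) `UntwistCollarP` and the BOOKKEEPING half (Υb) `UntwistBookkeepingP aHi Λ s` (TM l.88, «ELEMENTARY ACCOUNTING · TRUE-type · S»; an open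
leaf of the columns of record `_16XH16` / `_16XH17` / `_16XH18`, all at `aHi = 1`).  This file proves (Υb) at `aHi = 1` for every `Λ, s`:

  `untwistBookkeepingP_one : UntwistBookkeepingP 1 Λ s`.

Proof (as announced in TM's docstring): given the registering map `Ψ` (level `κ`, radius `4`, profile `τ`) and the layer-compatible bijective
bond isomorphism `Φ'` with few non-kept window sites, register the window by `Φ'` with the profile `τ₁ := τ` on KEPT sites and `τ₁ := 12`
elsewhere.  Kept site `y`: `τ y < 1/8`, so `Ψ y`, `Φ' y` lie in one layer of the chart and the environment clause transfers
(`envClose_of_sameLayer`); the radius-`4` gradient clause of `Φ'` at `y` IS that of `Ψ` (equal difference vectors).  Non-kept site: `EnvClose 12 4`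
holds trivially (anchor `q := Φ' y`, `p := y`), and the gradient clause `dist (p − y) (Φ' p − Φ' y) ≤ ‖p − y‖ + ‖Φ' p − Φ' y‖ ≤ 4 + 8` by
tear-freeness `bondIsoTearFreeP_one` (the door set is `IsCleanP 1`, the chart is clean by `IsEquilChart`).  Levels: `∑ τ₁² ≤ ∑ τ² + 144·#non-kept
≤ (1 + 144·C_c)·κ·#win`; the position clause holds at the free scale `ρ₁ := √(∑‖x − Φ' x‖² / ((1+144 C_c) κ #win))` (finite window,
`finite_atomsIn`).  No definitions, no `sorry`, standard axioms.  `--supports stmt-AtomisticToContinuum-26636`.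
-/

noncomputable section

open scoped BigOperators
open MeasureTheory Set Metric
open Summit.AtomisticToContinuum.Crystallization.Theorems.ChartedPlanarOrderRigidityDoor
  (E3 IsClean IsNash IsCharted VisibleGap PertRegime atomsIn)
open Summit.AtomisticToContinuum.Crystallization.Theorems.ChartedPlanarOrderDensityDichotomy (μS IsSep nK nK_nonneg)
open Summit.AtomisticToContinuum.Crystallization.Theorems.ChartedPlanarOrderMesoCut (LayeredHom layerOf EnvClose)
open Summit.AtomisticToContinuum.Crystallization.Theorems.ChartedPlanarOrderDoorLayered (PeriodicBulkGapDoor atomsIn_subset)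
open Summit.AtomisticToContinuum.Crystallization.Theorems.ChartedPlanarOrderCleanScaleP
  (IsCleanP IsDoorSetP isCleanP_one_iff)

namespace Summit.AtomisticToContinuum.Crystallization.Theorems.ChartedZeroExcessLayeredLatticeLiouville

/-- **(Υb) PROVED at `aHi = 1`:** `UntwistBookkeepingP 1 Λ s` for every `Λ, s` — the bookkeeping half of the untwist (Υ): a
layer-compatible bijective bond isomorphism `Φ'` with `≤ C_c·κ·#win` non-kept window sites registers the window at level `(1 + 144·C_c)·κ`
(radius `4`, free position scale), profile `τ` on kept sites and `12` elsewhere. [this file] -/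
theorem untwistBookkeepingP_one (Λ s : ℝ) : UntwistBookkeepingP 1 Λ s := by
  classical
  intro δ hδ a ha Cc hCc S hS κ hκ R hR L w Ψ ρ τ Φ' hE hreg hbij hiso hlay hfew
  set Q : Set E3 := atomsIn (μS S) 0 R with hQ
  set H : Set E3 := LayeredHom (L : E3 →L[ℝ] E3) w with hH
  obtain ⟨hinj, hmaps, henv, hgrad, hlev, hpos⟩ := hreg
  have hQS : Q ⊆ S := atomsIn_subset S R
  have hfin : Q.Finite := finite_atomsIn hδ hS.2.1 R
  -- tear-freeness of the bond isomorphism (B4 at `aHi = 1`)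
  have hclS : IsCleanP 1 (μS S) := hS.2.2.1
  have hclH : IsClean (μS H) := hE.2.2.2.1
  have htear := (bondIsoTearFreeP_one S H hclS hclH Φ' hbij hiso).1
  -- the window as a finset
  set F : Finset E3 := hfin.toFinset with hF
  have hmemF : ∀ x, x ∈ F ↔ x ∈ Q := fun x => Set.Finite.mem_toFinset hfin
  have hnKQ : nK Q = (F.card : ℝ) := by
    rw [nK, Set.ncard_eq_toFinset_card Q hfin]
  have hnKT : nK (Q ∩ {y | ¬ KeptSite Q Φ' Ψ τ y}) = ((F.filter fun y => ¬ KeptSite Q Φ' Ψ τ y).card : ℝ) := by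
    have e : Q ∩ {y | ¬ KeptSite Q Φ' Ψ τ y} = ↑(F.filter fun y => ¬ KeptSite Q Φ' Ψ τ y) := by
      ext y
      simp only [Set.mem_inter_iff, Set.mem_setOf_eq, Finset.coe_filter, hmemF]
    rw [nK, e, Set.ncard_coe_finset]
  -- the new profile
  set τ₁ : E3 → ℝ := fun y => if KeptSite Q Φ' Ψ τ y then τ y else 12 with hτ₁
  -- the new (free) position scale
  set M : ℝ := ∑ᶠ x ∈ Q, ‖x - Φ' x‖ ^ 2 with hM
  set κ' : ℝ := (1 + 144 * Cc) * κ with hκ'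
  have hκ'pos : 0 < κ' := by positivity
  set ρ₁ : ℝ := Real.sqrt (M / (κ' * nK Q)) with hρ₁
  refine ⟨ρ₁, τ₁, hbij.injOn.mono hQS, hbij.mapsTo.mono_left hQS, ?_, ?_, ?_, ?_⟩
  · -- nonnegativity and the environment clause
    intro x hx
    by_cases hk : KeptSite Q Φ' Ψ τ x
    · have hτx : τ₁ x = τ x := by simp [hτ₁, hk]
      rw [hτx]
      refine ⟨(henv x hx).1, ?_⟩
      obtain ⟨m, hΨm, hΦm⟩ := hlay x hx (hk.good hx)
      exact envClose_of_sameLayer hΨm hΦm (henv x hx).2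
    · have hτx : τ₁ x = 12 := by simp [hτ₁, hk]
      rw [hτx]
      refine ⟨by norm_num, fun p _ hpx => ⟨Φ' x, hbij.mapsTo (hQS hx), ?_⟩, fun q _ hqx => ⟨x, hQS hx, ?_⟩⟩
      · rw [sub_self, dist_zero_right, ← dist_eq_norm]
        linarith
      · rw [sub_self, dist_comm, dist_zero_right, ← dist_eq_norm]
        linarith
  · -- the radius-4 gradient clause
    intro x hx p hp hpx
    by_cases hk : KeptSite Q Φ' Ψ τ x
    · have hτx : τ₁ x = τ x := by simp [hτ₁, hk]
      rw [hτx, (hk p hp hpx).2]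
      exact hgrad x hx p hp hpx
    · have hτx : τ₁ x = 12 := by simp [hτ₁, hk]
      rw [hτx]
      have h8 : dist (Φ' p) (Φ' x) ≤ 8 := htear x (hQS hx) p (hQS hp) hpx
      have h4 : ‖p - x‖ ≤ 4 := by rwa [← dist_eq_norm]
      have h8' : ‖Φ' p - Φ' x‖ ≤ 8 := by rwa [← dist_eq_norm]
      calc dist (p - x) (Φ' p - Φ' x) ≤ ‖p - x‖ + ‖Φ' p - Φ' x‖ := by
            rw [dist_eq_norm]
            exact norm_sub_le _ _
        _ ≤ 12 := by linarith
  · -- the gradient level: `∑ τ₁² ≤ ∑ τ² + 144·#non-kept ≤ (1 + 144 C_c) κ #win`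
    have hpt : ∀ x ∈ F, τ₁ x ^ 2 ≤ τ x ^ 2 + 144 * (if ¬ KeptSite Q Φ' Ψ τ x then (1 : ℝ) else 0) := by
      intro x _
      by_cases hk : KeptSite Q Φ' Ψ τ x
      · simp [hτ₁, hk]
      · simp only [hτ₁, hk, if_false, not_false_eq_true, if_true]
        nlinarith [sq_nonneg (τ x)]
    have hcard : ∑ x ∈ F, (if ¬ KeptSite Q Φ' Ψ τ x then (1 : ℝ) else 0) =
        ((F.filter fun y => ¬ KeptSite Q Φ' Ψ τ y).card : ℝ) := by
      rw [Finset.card_filter]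
      push_cast
      rfl
    have hlevF : ∑ x ∈ F, τ x ^ 2 ≤ κ * nK Q := by
      rwa [finsum_mem_eq_finite_toFinset_sum _ hfin] at hlev
    rw [finsum_mem_eq_finite_toFinset_sum _ hfin]
    calc ∑ x ∈ F, τ₁ x ^ 2 ≤ ∑ x ∈ F, (τ x ^ 2 + 144 * (if ¬ KeptSite Q Φ' Ψ τ x then (1 : ℝ) else 0)) :=
          Finset.sum_le_sum hpt
      _ = ∑ x ∈ F, τ x ^ 2 + 144 * nK (Q ∩ {y | ¬ KeptSite Q Φ' Ψ τ y}) := by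
          rw [Finset.sum_add_distrib, ← Finset.mul_sum, hcard, hnKT]
      _ ≤ κ * nK Q + 144 * (Cc * κ * nK Q) := add_le_add hlevF (mul_le_mul_of_nonneg_left hfew (by norm_num))
      _ = κ' * nK Q := by simp only [hκ']; ring
  · -- the position level at the free scale `ρ₁`
    have hM0 : 0 ≤ M := finsum_nonneg fun x => finsum_nonneg fun _ => sq_nonneg _
    by_cases hQ0 : nK Q = 0
    · have hQe : Q = ∅ := by
        have h0 : Q.ncard = 0 := by
          have h := hQ0
          rw [nK] at h
          exact_mod_cast h
        exact (Set.ncard_eq_zero hfin).1 h0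
      have hM' : M = 0 := by simp [hM, hQe]
      show M ≤ κ' * ρ₁ ^ 2 * nK Q
      rw [hM', hQ0, mul_zero]
    · have hQpos : 0 < nK Q := lt_of_le_of_ne (nK_nonneg Q) (Ne.symm hQ0)
      have hρ₁sq : ρ₁ ^ 2 = M / (κ' * nK Q) := Real.sq_sqrt (div_nonneg hM0 (by positivity))
      show M ≤ κ' * ρ₁ ^ 2 * nK Q
      rw [hρ₁sq]
      apply le_of_eq
      field_simp

/-! ## Consequences: (Υ) from (Υc) alone, and the column of record without the (Υb) slot -/

/-- **(Υ) ⟸ (Υc) at `aHi = 1` (PROVED):** the untwist needs only its rigidity half. [`lateralUntwistP_of_collar_book`, `untwistBookkeepingP_one`] -/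
theorem lateralUntwistP_one_of_collar {Λ θ s : ℝ} (hc : UntwistCollarP 1 Λ θ s) : LateralUntwistP 1 Λ θ s :=
  lateralUntwistP_of_collar_book hc (untwistBookkeepingP_one Λ s)

/-- ★ **COLUMN `_16XH16` WITHOUT THE (Υb) SLOT (PROVED; 20 leaves)**: the 26636 column of record `gap_and_pert_1_50_of_certs_16XH16` (part TO)
with `hUb : UntwistBookkeepingP 1 2 (1/50)` discharged by `untwistBookkeepingP_one`. [this file] -/
theorem gap_and_pert_1_50_of_certs_16XH16_ub (hL : LatticeLiouvilleCert) (hL' : LayeredLiouvilleCert)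
    (hR : OscRigidityL2BDPG 1 2 (1 / 16) (1 / 16)) (hX : ExcessFlatnessControlP 1 2 (1 / 16) (1 / 16))
    (hE : ExcessChartLocalisationP 1 2 (1 / 16) (1 / 100)) (hP : RegistrationP 1 2 (1 / 16) (1 / 100))
    (hT : TailDominationCert) (hU : UniformTameStability (1 / 50) 2)
    (h1 : WordTransplantP 1 2 (1 / 16) (1 / 100)) (hGT : GradReframingThickP 1 2 (1 / 16) (1 / 100) (1 / 50))
    (hGl : ThinLaunderingPX 1 2 (1 / 16) (1 / 100) (1 / 50))
    (hUc : UntwistCollarP 1 2 (1 / 16) (1 / 50))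
    (hl : BondIsoLevelsP 1 2 (1 / 16) (1 / 50))
    (hF : TailForceSlavingP 1 2 (1 / 16) (1 / 50))
    (hE' : LipDualLinearisationP 1 2 (1 / 16) (1 / 50)) (hA : L2HarmonicApproxP 1 2 (1 / 16) (1 / 50))
    (hD : PositionDecayPL 1 2 (1 / 16) (1 / 50)) (hC : PositionCaccioppoliPG 1 2 (1 / 16) (1 / 50))
    (hW : WildFractionPG 1 2 (1 / 16) (1 / 50)) (hG : PeriodicBulkGapDoor 2) : VisibleGap (1 / 50) ∧ PertRegime (1 / 50) :=
  gap_and_pert_1_50_of_certs_16XH16 hL hL' hR hX hE hP hT hU h1 hGT hGl hUc (untwistBookkeepingP_one 2 (1 / 50)) hl hF hE' hA hD hC hW hG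

end Summit.AtomisticToContinuum.Crystallization.Theorems.ChartedZeroExcessLayeredLatticeLiouville
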